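import Mathlib
import Summits.ValiantsHypothesis.ValiantsHypothesis.Theses.FreeSubtorus
import Literature.Computability.AlgebraicComplexity.GrenetEquivariant
import Literature.Computability.AlgebraicComplexity.LRPencilOfMatrix
import Literature.Computability.AlgebraicComplexity.OrbitClosureProofs

/-!
# `SubtorusCovering`, line `pair-sacrifice` — stub `stub_relabel`

Crux stmt-ValiantsHypothesis-16134
(`Summit.ValiantsHypothesis.ValiantsHypothesis.Theses.FreeSubtorus.SubtorusCovering`), route
`route-ValiantsHypothesis-FreeSubtorus`.

**The relabelling step.**  Permuting the rows of the variable matrix by `ρ` and the columns by `κ`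
(`x_{(k,l)} ↦ x_{(ρ k, κ l)}`, i.e. `B ↦ B.map (rename (Prod.map ρ κ))`) turns a `T_Λ`-equivariant
affine determinantal representation of `per_n` (exact `GL_m × GL_m` lifts, `IsEquivariantDetRepr`)
into a `T_{Λ'}`-equivariant one, where `Λ' i (inl k) = Λ i (inl (ρ⁻¹ k))` and
`Λ' i (inr l) = Λ i (inr (κ⁻¹ l))`.

Proof.  (a) Renaming does not raise total degrees, so the entries stay affine.  (b) The determinant
commutes with the algebra map `rename`, and `per_n` is invariant under independent relabellings of
rows and columns (`rename_prodMap_perPoly`: reindex the permanent's sum over `π` by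
`π ↦ ρ ∘ π ∘ κ⁻¹` and its product by `κ`).  (c) Lifts of generators suffice
(`IsEquivariantDetRepr.of_generators`).  A generator `γ' = diag(d'_k e'_l)` of `T_{Λ'}` is the
transport of the generator `γ = diag(d_k e_l)`, `d = d' ∘ ρ`, `e = e' ∘ κ`, of `T_Λ` (the relations
are reindexed by `ρ`, `κ`), and `rename f ∘ (x_p ↦ c_p x_p) = (x_q ↦ c'_q x_q) ∘ rename f` whenever
`c' (f p) = c p` (`rename_comp_linSubst_diagonal`); hence
`(B.map (rename f))(γ' · x) = (B(γ · x)).map (rename f) = g · B.map (rename f) · h⁻¹` for the lift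
`(g, h)` of `γ`, because `rename` fixes the constant matrices `g`, `h⁻¹`.
-/

set_option linter.dupNamespace false

namespace Summit.ValiantsHypothesis.ValiantsHypothesis.Theorems.FreeSubtorusSubtorusCovering

open Literature.Computability.AlgebraicComplexity MvPolynomial

/-- The generic permanent is invariant under independent relabellings of rows and columns:
`per (x_{ρ k, κ l}) = per (x_{k l})` (reindex `π ↦ ρ ∘ π ∘ κ⁻¹`, then the product by `κ`).
[folklore] -/
theorem rename_prodMap_perPoly {n : Type*} [Fintype n] [DecidableEq n] (k : Type*) [CommRing k]
    (ρ κ : Equiv.Perm n) :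
    rename (Prod.map ρ κ) (perPoly n k) = perPoly n k := by
  -- adapted from `rename_perPoly_equiv` (OrbitClosureProofs.lean)
  simp only [perPoly, Matrix.permanent, map_sum, map_prod, Matrix.mvPolynomialX_apply, rename_X,
    Prod.map_apply]
  refine Fintype.sum_equiv (κ.equivCongr ρ) _ _ fun π => ?_
  refine Fintype.prod_equiv κ _ _ fun i => ?_
  simp [Equiv.equivCongr_apply_apply]

/-- Renaming variables commutes past diagonal substitutions whose weights are transported along
the renaming: `rename f ∘ (x_p ↦ c_p x_p) = (x_q ↦ c'_q x_q) ∘ rename f` when `c' (f p) = c p`.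
[folklore] -/
theorem rename_comp_linSubst_diagonal {σ τ : Type*} [Fintype σ] [DecidableEq σ] [Fintype τ]
    [DecidableEq τ] {k : Type*} [Field k] (f : σ → τ) (c : σ → k) (c' : τ → k)
    (h : ∀ p, c' (f p) = c p) :
    (rename f).comp (linSubst σ k (Matrix.diagonal c)) =
      (linSubst τ k (Matrix.diagonal c')).comp (rename f) := by
  apply MvPolynomial.algHom_ext
  intro p
  rw [AlgHom.comp_apply, AlgHom.comp_apply, Grenet.linSubst_diagonal_X, map_smul, rename_X,
    Grenet.linSubst_diagonal_X, h]

/-- Entrywise form: substituting the transported diagonal element into the relabelled matrix is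
the relabelling of the substituted matrix. [folklore] -/
theorem linSubstEntries_map_rename_diagonal {σ τ : Type*} [Fintype σ] [DecidableEq σ] [Fintype τ]
    [DecidableEq τ] {k : Type*} [Field k] {ι : Type*} (f : σ → τ) (c : σ → k) (c' : τ → k)
    (h : ∀ p, c' (f p) = c p) (γ : GL σ k) (γ' : GL τ k)
    (hγ : (γ : Matrix σ σ k) = Matrix.diagonal c) (hγ' : (γ' : Matrix τ τ k) = Matrix.diagonal c')
    (B : Matrix ι ι (MvPolynomial σ k)) :
    Matrix.linSubstEntries γ' (B.map (rename f)) =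
      (Matrix.linSubstEntries γ B).map (rename f) := by
  have hc := rename_comp_linSubst_diagonal f c c' h
  refine Matrix.ext fun i j => ?_
  simp only [Matrix.linSubstEntries, Matrix.map_apply, hγ, hγ']
  exact (DFunLike.congr_fun hc (B i j)).symm

/-- **Stub `stub_relabel` (line `pair-sacrifice`, crux stmt-ValiantsHypothesis-16134).**
Relabelling rows by `ρ` and columns by `κ` (`B ↦ B.map (rename (Prod.map ρ κ))`) turns a
`T_Λ`-equivariant affine determinantal representation of `per_n` into a `T_{Λ'}`-equivariant one,
`Λ' = Λ ∘ (ρ⁻¹ ⊔ κ⁻¹)`: affineness by `totalDegree_rename_le`, the determinant by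
`rename_prodMap_perPoly`, and the lift of a generator `diag(d'_k e'_l)` of `T_{Λ'}` is the lift of
the generator `diag(d'_{ρ k} e'_{κ l})` of `T_Λ`, pushed through `rename`
(`linSubstEntries_map_rename_diagonal`, `IsEquivariantDetRepr.of_generators`). [folklore] -/
theorem stub_relabel :
    ∀ (n r m : ℕ) (Λ : Fin r → (Fin n ⊕ Fin n) → ℤ)
    (B : Matrix (Fin m) (Fin m) (MvPolynomial (Fin n × Fin n) ℂ)) (ρ κ : Equiv.Perm (Fin n)),
    IsEquivariantDetRepr (Subgroup.closure {γ : Matrix.GeneralLinearGroup (Fin n × Fin n) ℂ |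
        ∃ d e : Fin n → ℂˣ,
          (∀ i, (∏ k, (d k) ^ (Λ i (Sum.inl k))) * (∏ l, (e l) ^ (Λ i (Sum.inr l))) = 1) ∧
          (γ : Matrix (Fin n × Fin n) (Fin n × Fin n) ℂ) =
            Matrix.diagonal (fun p => (d p.1 : ℂ) * (e p.2 : ℂ))})
      (perPoly (Fin n) ℂ) B →
    IsEquivariantDetRepr (Subgroup.closure {γ : Matrix.GeneralLinearGroup (Fin n × Fin n) ℂ |
        ∃ d e : Fin n → ℂˣ,
          (∀ i, (∏ k, (d k) ^ (Λ i (Sum.inl (ρ.symm k)))) *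
              (∏ l, (e l) ^ (Λ i (Sum.inr (κ.symm l)))) = 1) ∧
          (γ : Matrix (Fin n × Fin n) (Fin n × Fin n) ℂ) =
            Matrix.diagonal (fun p => (d p.1 : ℂ) * (e p.2 : ℂ))})
      (perPoly (Fin n) ℂ) (B.map (MvPolynomial.rename (Prod.map ρ κ))) := by
  intro n r m Λ B ρ κ hB
  refine IsEquivariantDetRepr.of_generators ⟨fun i j => ?_, ?_⟩ ?_
  · -- (a) affineness survives renaming
    rw [Matrix.map_apply]
    exact (totalDegree_rename_le _ _).trans (hB.1.1 i j)
  · -- (b) the determinant: `det (B.map (rename f)) = rename f (det B) = rename f per = per`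
    rw [← AlgHom.mapMatrix_apply, ← AlgHom.map_det, hB.1.2, rename_prodMap_perPoly]
  · -- (c) lifts of the generators of `T_{Λ'}`
    rintro γ' ⟨d', e', hrel', hγ'⟩
    -- the transported element `γ = diag (d'_{ρ k} e'_{κ l})` of `T_Λ`
    have hrel : ∀ i, (∏ k, (d' (ρ k)) ^ (Λ i (Sum.inl k))) *
        (∏ l, (e' (κ l)) ^ (Λ i (Sum.inr l))) = 1 := by
      intro i
      rw [← hrel' i]
      congr 1
      · exact Fintype.prod_equiv ρ _ _ fun k => by rw [Equiv.symm_apply_apply]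
      · exact Fintype.prod_equiv κ _ _ fun l => by rw [Equiv.symm_apply_apply]
    let γ : GL (Fin n × Fin n) ℂ :=
      Grenet.diagUnit (fun p : Fin n × Fin n => (d' (ρ p.1) : ℂ) * (e' (κ p.2) : ℂ))
        (fun p => mul_ne_zero (d' (ρ p.1)).ne_zero (e' (κ p.2)).ne_zero)
    have hγ : (γ : Matrix (Fin n × Fin n) (Fin n × Fin n) ℂ) =
        Matrix.diagonal (fun p : Fin n × Fin n => (d' (ρ p.1) : ℂ) * (e' (κ p.2) : ℂ)) := rfl
    have hγmem : γ ∈ Subgroup.closure {γ : Matrix.GeneralLinearGroup (Fin n × Fin n) ℂ |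
        ∃ d e : Fin n → ℂˣ,
          (∀ i, (∏ k, (d k) ^ (Λ i (Sum.inl k))) * (∏ l, (e l) ^ (Λ i (Sum.inr l))) = 1) ∧
          (γ : Matrix (Fin n × Fin n) (Fin n × Fin n) ℂ) =
            Matrix.diagonal (fun p => (d p.1 : ℂ) * (e p.2 : ℂ))} :=
      Subgroup.subset_closure ⟨fun k => d' (ρ k), fun l => e' (κ l), hrel, hγ⟩
    obtain ⟨g, h, hgh⟩ := hB.2 γ hγmem
    refine ⟨g, h, ?_⟩
    have hC : (⇑(rename (Prod.map ρ κ) : MvPolynomial (Fin n × Fin n) ℂ →ₐ[ℂ]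
        MvPolynomial (Fin n × Fin n) ℂ)) ∘ (C : ℂ → MvPolynomial (Fin n × Fin n) ℂ) = C :=
      funext fun a => rename_C _ a
    rw [linSubstEntries_map_rename_diagonal (Prod.map ρ κ)
        (fun p : Fin n × Fin n => (d' (ρ p.1) : ℂ) * (e' (κ p.2) : ℂ))
        (fun q : Fin n × Fin n => (d' q.1 : ℂ) * (e' q.2 : ℂ)) (fun p => rfl) γ γ' hγ hγ' B,
      hgh, Matrix.map_mul, Matrix.map_mul, Matrix.map_map, Matrix.map_map, hC]

end Summit.ValiantsHypothesis.ValiantsHypothesis.Theorems.FreeSubtorusSubtorusCovering
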